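import Summits.PneNP.PneNP.Theorems.ExpanderLinearGeneratorsLinearGeneratorModPFregeHardMod2Row
import Mathlib.Order.SymmDiff
import HarnessLib

/-!
# `MOD₂` summation, abstract level, III: summing the certificate rows, and the contradiction

Support file for item `stmt-PneNP-11444` (`LinearGeneratorModPFregeHard`), calibration line "for
`p = 2` the rung fails: `MOD₂` gates sum the certificate rows in polynomial size".  Setting as in
`…Mod2Xor.lean`, `…Mod2RowWalk.lean`, `…Mod2Row.lean` (atoms `var (zv c k κ)` for the `MOD₂`
subformulas, skeleton hypotheses negated in the context `K`, `Y k κ = x_k` or `⊥` according to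
the set `Dof κ` of the kind `κ`).  The kinds are now: the certificate rows `κr (row t)`, `t < q`
(supports `Dof (κr (row t))`, right-hand sides `brow (row t)`), and the accumulated symmetric
differences `κa t`, `t ≤ q` (`Dof (κa 0) = ∅`, `Dof (κa (t+1)) = Dof (κa t) ∆ Dof (κr (row t))`).
A certificate of unsolvability over `𝔽₂` is exactly: `Dof (κa q) = ∅` (every variable occurs an
even number of times) while `Σ_t brow (row t) = 1`.

* `sq_xor_combine'` — `Z(c,n,κD), Z(b,n,κS) ⊢ Z(c+b,n,κE)` with ADDITIVE cost (the three facts are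
  cut one after the other; the multiplicative form of `…Mod2Xor.lean` would make the chain
  exponential);
* `sq_chain` — `⊢ Z(Σ_{s<t} b_s, n, κa t), K` for all `t ≤ q`, by induction (start: the walk of an
  empty support; step: the row fact of `…Mod2Row.lean` and `sq_xor_combine'`);
* `sq_endgame` — from `Z(1,n,κa q)` with `Dof (κa q) = ∅` down to `Z(1,0,κa q)`, which contradicts
  axiom 2: the context `K` itself is derivable, `sq_refute`.

No definitions are introduced; all objects are section variables with defining hypotheses.

Sources: S. Buss et al., Comput. Complexity 6 (1996/97), Def. 1.1; the summation argument is the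
folklore remark of the item's docstring; P. Clote, E. Kranakis, *Boolean Functions and
Computation Models* (2002), §5.5.3 (Gaussian refutations over `𝔽₂` = symmetric differences of
row sets, cf. `GaussianWidth.lean`).
-/

set_option linter.dupNamespace false -- `Summit.PneNP.PneNP.…`: summit = sub-problem (D-0017)

namespace Summit.PneNP.PneNP.Theorems.ModTwo

open Literature.Computability.Complexity Literature.Computability.Complexity.PropForm
open Literature.Computability.MetaComplexity Literature.Computability.MetaComplexity.DepthFrege
open Literature.Computability.MetaComplexity.TextbookFrege (disjList disjList_nil disjList_cons)
open Literature.Computability.MetaComplexity.KEval (litForm clauseForm clauseForm_cons)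
open scoped symmDiff

section Chain

variable {Q : SPrm} (zv : ZMod 2 → ℕ → ℕ → ℕ) (Y : ℕ → ℕ → PropForm ℕ)
  (H3 : ZMod 2 → ℕ → ℕ → PropForm ℕ) (n : ℕ) (K : List (PropForm ℕ))

/-! ### Combining two parities with additive cost -/

/-- **Combining two parities, additive cost.** Under the hypotheses of `sq_xor_level` for the
kinds `κD, κS, κE`, from `⊢ Z(c,n,κD), K` (in `tD` ticks) and `⊢ Z(b,n,κS), K` (in `tS` ticks)
infer `⊢ Z(c+b,n,κE), K` in `2^(N+2) + (2^(N+2)+2)(n+1) + tD + tS + 5` ticks: the small tautology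
`¬Φ n, ¬Z(c,n,κD), ¬Z(b,n,κS), Z(c+b,n,κE)` is cut against the three facts one after the other.
[Buss et al. 1997, Def. 1.1] [folklore] -/
theorem sq_xor_combine' (Φ : ℕ → PropForm ℕ) (κD κS κE : ℕ)
    (hH3₀ : ∀ k κ, H3 0 k κ = PropForm.biimp (var (zv 0 (k + 1) κ))
      (disj (conj (var (zv 0 k κ)) (neg (Y k κ))) (conj (var (zv 1 k κ)) (Y k κ))))
    (hH3₁ : ∀ k κ, H3 1 k κ = PropForm.biimp (var (zv 1 (k + 1) κ))
      (disj (conj (var (zv 1 k κ)) (neg (Y k κ))) (conj (var (zv 0 k κ)) (Y k κ))))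
    (hΦ : ∀ k, Φ k =
      conj (disj (neg (var (zv 0 k κD))) (disj (neg (var (zv 0 k κS))) (var (zv 0 k κE))))
      (conj (disj (neg (var (zv 0 k κD))) (disj (neg (var (zv 1 k κS))) (var (zv 1 k κE))))
      (conj (disj (neg (var (zv 1 k κD))) (disj (neg (var (zv 0 k κS))) (var (zv 1 k κE))))
      (disj (neg (var (zv 1 k κD))) (disj (neg (var (zv 1 k κS))) (var (zv 0 k κE)))))))
    (hY : ∀ k κ, Y k κ = var k ∨ Y k κ = const false)
    (hYE : ∀ k (τ : ℕ → Bool), k < n →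
      (Y k κE).eval τ = xor ((Y k κD).eval τ) ((Y k κS).eval τ))
    (hKb : ∀ A ∈ K, Base Q A) (hQ : 8 ≤ Q.D ∧ 40 ≤ Q.M)
    (hK3 : ∀ (c : ZMod 2) (k : ℕ), k < n →
      neg (H3 c k κD) ∈ K ∧ neg (H3 c k κS) ∈ K ∧ neg (H3 c k κE) ∈ K)
    (hK1 : neg (var (zv 0 0 κE)) ∈ K)
    (hK2 : neg (neg (var (zv 1 0 κD))) ∈ K ∧ neg (neg (var (zv 1 0 κS))) ∈ K)
    {N : ℕ} (hN : 6000 ≤ N) (hW : K.length + N + 12 ≤ Q.W)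
    {tD tS : ℕ} {c b : ZMod 2} (hDf : Sq Q tD (var (zv c n κD) :: K))
    (hSf : Sq Q tS (var (zv b n κS) :: K)) :
    Sq Q (2 ^ (N + 2) + (2 ^ (N + 2) + 2) * (n + 1) + tD + tS + 5)
      (var (zv (c + b) n κE) :: K) := by
  have hlev := sq_xor_level zv Y H3 Φ κD κS κE n K hH3₀ hH3₁ hΦ hY hYE hKb hQ hK3 hK1 hK2 hN hW
    n le_rfl
  have hΦb := bounds_Phi (hΦ n)
  have hvb : ∀ v, Base Q (var v) := fun v =>
    base_of_bounds hQ (by simp [altDepth, altDepthAux]) (by simp [size])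
  have hnvb : ∀ v, Base Q (neg (var v)) := fun v =>
    base_of_bounds hQ (by simp [altDepth, altDepthAux]) (by simp [size])
  have hnΦ : Base Q (neg (Φ n)) :=
    base_of_bounds hQ (by rw [hΦb.2.2.2]; norm_num) (by rw [hΦb.2.1]; norm_num)
  set zD := zv c n κD with hzD
  set zS := zv b n κS with hzS
  set zE := zv (c + b) n κE with hzE
  -- the small tautology
  have htaut : (disjList [neg (Φ n), neg (var zD), neg (var zS), var zE]).IsTautology := by
    refine ltaut_iff.2 fun τ => ?_
    by_cases hF : (Φ n).eval τ = true
    · by_cases hD : τ zD = true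
      · by_cases hS : τ zS = true
        · refine ⟨var zE, by simp, ?_⟩
          rw [hΦ] at hF
          simp only [eval] at hF
          have hc2 : ∀ c : ZMod 2, c = 0 ∨ c = 1 := by decide
          simp only [eval, hzE]
          rw [hzD] at hD
          rw [hzS] at hS
          obtain rfl | rfl := hc2 c
          · obtain rfl | rfl := hc2 b
            · simp only [hD, hS, Bool.not_true, Bool.false_or, Bool.and_eq_true] at hF
              simpa using hF.1
            · simp only [hD, hS, Bool.not_true, Bool.false_or, Bool.and_eq_true] at hF
              simpa using hF.2.1
          · obtain rfl | rfl := hc2 b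
            · simp only [hD, hS, Bool.not_true, Bool.false_or, Bool.and_eq_true] at hF
              simpa using hF.2.2.1
            · simp only [hD, hS, Bool.not_true, Bool.false_or, Bool.and_eq_true] at hF
              have e : (1 : ZMod 2) + 1 = 0 := by decide
              simpa [e] using hF.2.2.2
        · exact ⟨neg (var zS), by simp, by simpa [eval] using hS⟩
      · exact ⟨neg (var zD), by simp, by simpa [eval] using hD⟩
    · exact ⟨neg (Φ n), by simp, by simpa [eval] using hF⟩
  have hsmall : Sq Q (2 ^ (N + 2) - 2) [neg (Φ n), neg (var zD), neg (var zS), var zE] := by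
    refine sq_complete N _ ?_ htaut ?_ ?_
    · norm_num [hΦb.1, size]; omega
    · intro A hA
      simp only [List.mem_cons, List.not_mem_nil, or_false] at hA
      rcases hA with rfl | rfl | rfl | rfl
      · exact hnΦ
      · exact hnvb _
      · exact hnvb _
      · exact hvb _
    · simp only [List.length_cons, List.length_nil]; omega
  have hlen := hDf.length_le
  simp only [List.length_cons] at hlen
  have hB3 : ∀ A ∈ neg (var zD) :: neg (var zS) :: var zE :: K, Base Q A := by
    intro A hA
    simp only [List.mem_cons] at hA
    rcases hA with rfl | rfl | rfl | hA
    · exact hnvb _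
    · exact hnvb _
    · exact hvb _
    · exact hKb A hA
  -- cut against `Φ n`
  have h1 : Sq Q (2 ^ (N + 2) - 2 + 1) (neg (Φ n) :: neg (var zD) :: neg (var zS) :: var zE :: K) :=
    hsmall.weaken (by intro A hA; simp only [List.mem_cons, List.not_mem_nil, or_false] at hA ⊢; tauto)
      (by
        intro A hA
        rcases List.mem_cons.1 hA with rfl | hA
        · exact hnΦ
        · exact hB3 A hA)
      (by simp only [List.length_cons]; omega)
  have h1' : Sq Q ((2 ^ (N + 2) + 2) * (n + 1) + 1)
      (Φ n :: neg (var zD) :: neg (var zS) :: var zE :: K) :=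
    hlev.weaken (by intro A hA; simp only [List.mem_cons] at hA ⊢; tauto)
      (by
        intro A hA
        rcases List.mem_cons.1 hA with rfl | hA
        · exact hlev.base _ (by simp)
        · exact hB3 A hA)
      (by simp only [List.length_cons]; omega)
  have h2 := Sq.cut h1' h1
  -- cut against `Z(c,n,κD)`
  have h2' : Sq Q (tD + 1) (var zD :: neg (var zS) :: var zE :: K) :=
    hDf.weaken (by intro A hA; simp only [List.mem_cons] at hA ⊢; tauto)
      (by
        intro A hA
        rcases List.mem_cons.1 hA with rfl | hA
        · exact hvb _
        · exact hB3 A (List.mem_cons_of_mem _ hA))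
      (by simp only [List.length_cons]; omega)
  have h3 := Sq.cut h2' h2
  -- cut against `Z(b,n,κS)`
  have h3' : Sq Q (tS + 1) (var zS :: var zE :: K) :=
    hSf.weaken (by intro A hA; simp only [List.mem_cons] at hA ⊢; tauto)
      (by
        intro A hA
        rcases List.mem_cons.1 hA with rfl | hA
        · exact hvb _
        · exact hB3 A (List.mem_cons_of_mem _ (List.mem_cons_of_mem _ hA)))
      (by simp only [List.length_cons]; omega)
  have h4 := Sq.cut h3' h3
  refine h4.mono ?_
  have : 2 ≤ 2 ^ (N + 2) := by
    calc (2 : ℕ) = 2 ^ 1 := by norm_num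
      _ ≤ 2 ^ (N + 2) := Nat.pow_le_pow_right (by norm_num) (by omega)
  omega

/-! ### The chain over the certificate rows -/

/-- **Summing the certificate rows.** With kinds `κa t` (accumulated symmetric differences,
`Dof (κa 0) = ∅`, `Dof (κa (t+1)) = Dof (κa t) ∆ Dof (κr (row t))`) and `κr (row t)` (the rows,
with their canonical clauses negated in `K`), the fact `Z(Σ_{s<t} b_s, n, κa t)` is derivable for
every `t ≤ q`, within `(2^(N+2)+3)(n+1) + Σ_{s<t} (rowCost s + 2^(N+2) + (2^(N+2)+2)(n+1) + 5)`
ticks, `rowCost s = 2^|S_s|·((2^(N+2)+3)(n+1) + 2|S_s| + 5)`. [Buss et al. 1997, Def. 1.1;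
Clote–Kranakis 2002, §5.5.3] [folklore] -/
theorem sq_chain
    (hH3₀ : ∀ k κ, H3 0 k κ = PropForm.biimp (var (zv 0 (k + 1) κ))
      (disj (conj (var (zv 0 k κ)) (neg (Y k κ))) (conj (var (zv 1 k κ)) (Y k κ))))
    (hH3₁ : ∀ k κ, H3 1 k κ = PropForm.biimp (var (zv 1 (k + 1) κ))
      (disj (conj (var (zv 1 k κ)) (neg (Y k κ))) (conj (var (zv 0 k κ)) (Y k κ))))
    (Dof : ℕ → Finset ℕ) (hYdef : ∀ k κ, Y k κ = if k ∈ Dof κ then var k else const false)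
    (κr κa row : ℕ → ℕ) (brow : ℕ → ZMod 2) (q : ℕ) (Φc : ℕ → ℕ → PropForm ℕ)
    (hΦc : ∀ t k, Φc t k =
      conj (disj (neg (var (zv 0 k (κa t)))) (disj (neg (var (zv 0 k (κr (row t)))))
        (var (zv 0 k (κa (t + 1))))))
      (conj (disj (neg (var (zv 0 k (κa t)))) (disj (neg (var (zv 1 k (κr (row t)))))
        (var (zv 1 k (κa (t + 1))))))
      (conj (disj (neg (var (zv 1 k (κa t)))) (disj (neg (var (zv 0 k (κr (row t)))))
        (var (zv 1 k (κa (t + 1))))))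
      (disj (neg (var (zv 1 k (κa t)))) (disj (neg (var (zv 1 k (κr (row t)))))
        (var (zv 0 k (κa (t + 1)))))))))
    (hacc : ∀ t, t < q → Dof (κa (t + 1)) = Dof (κa t) ∆ Dof (κr (row t)))
    (hD0 : Dof (κa 0) = ∅) (hDn : ∀ κ, ∀ v ∈ Dof κ, v < n)
    (hKb : ∀ A ∈ K, Base Q A) (hQ : 8 ≤ Q.D ∧ 40 ≤ Q.M)
    (hK3r : ∀ (c : ZMod 2) (k t : ℕ), k < n → t < q → neg (H3 c k (κr (row t))) ∈ K)
    (hK3a : ∀ (c : ZMod 2) (k t : ℕ), k < n → t ≤ q → neg (H3 c k (κa t)) ∈ K)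
    (hK1r : ∀ t, t < q → neg (var (zv 0 0 (κr (row t)))) ∈ K)
    (hK1a : ∀ t, t ≤ q → neg (var (zv 0 0 (κa t))) ∈ K)
    (hK2r : ∀ t, t < q → neg (neg (var (zv 1 0 (κr (row t))))) ∈ K)
    (hK2a : ∀ t, t ≤ q → neg (neg (var (zv 1 0 (κa t)))) ∈ K)
    (hKcl : ∀ t, t < q → ∀ ρ : ℕ → Bool,
      (((((Dof (κr (row t))).sort (· ≤ ·)).filter fun v => ρ v).length : ℕ) : ZMod 2) ≠
          brow (row t) →
        neg (clauseForm (((Dof (κr (row t))).sort (· ≤ ·)).map fun v => (v, !ρ v))) ∈ K)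
    {N : ℕ} (hN : 6000 ≤ N) (hW : K.length + n + N + 12 ≤ Q.W) :
    ∀ t, t ≤ q →
      Sq Q ((2 ^ (N + 2) + 3) * (n + 1) + (Finset.range t).sum (fun s =>
          2 ^ (Dof (κr (row s))).card * ((2 ^ (N + 2) + 3) * (n + 1) +
            2 * (Dof (κr (row s))).card + 5) + 2 ^ (N + 2) + (2 ^ (N + 2) + 2) * (n + 1) + 5))
        (var (zv ((Finset.range t).sum fun s => brow (row s)) n (κa t)) :: K) := by
  have hY : ∀ k κ, Y k κ = var k ∨ Y k κ = const false := by
    intro k κ; rw [hYdef]; split_ifs <;> simp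
  have hcard : ∀ κ, (Dof κ).card ≤ n := fun κ => by
    calc (Dof κ).card ≤ (Finset.range n).card :=
          Finset.card_le_card fun v hv => Finset.mem_range.2 (hDn κ v hv)
      _ = n := Finset.card_range n
  intro t
  induction t with
  | zero =>
    intro _
    -- the walk of the empty support
    have hw := sq_row_walk zv Y H3 (κa 0) ∅ n K hH3₀ hH3₁ hY
      (fun k => by rw [hYdef, hD0]) hKb hQ (fun c k hk => hK3a c k 0 hk (Nat.zero_le _))
      (hK1a 0 (Nat.zero_le _)) (N := N) (by omega) (by simp; omega) n le_rfl (fun _ => false)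
    simp only [Finset.filter_empty, Finset.sort_empty, List.filter_nil, List.length_nil,
      Nat.cast_zero, List.map_nil, List.nil_append] at hw
    simpa using hw
  | succ t ih =>
    intro ht
    have ht' : t < q := Nat.lt_of_succ_le ht
    have ihD := ih ht'.le
    -- the row fact
    have hrow := sq_row zv Y H3 (κr (row t)) (Dof (κr (row t))) n K hH3₀ hH3₁ hY
      (fun k => hYdef k _) hKb hQ (fun c k hk => hK3r c k t hk ht') (hK1r t ht') (N := N)
      (by omega) (by have := hcard (κr (row t)); omega) (hDn _) (hKcl t ht')
    -- combine
    have hYE : ∀ k (τ : ℕ → Bool), k < n → (Y k (κa (t + 1))).eval τ =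
        xor ((Y k (κa t)).eval τ) ((Y k (κr (row t))).eval τ) := by
      intro k τ _
      rw [hYdef k (κa (t + 1)), hYdef k (κa t), hYdef k (κr (row t)), hacc t ht']
      by_cases h1 : k ∈ Dof (κa t) <;> by_cases h2 : k ∈ Dof (κr (row t)) <;>
        simp [Finset.mem_symmDiff, h1, h2, eval]
    have hc := sq_xor_combine' zv Y H3 n K (Φc t) (κa t) (κr (row t)) (κa (t + 1)) hH3₀ hH3₁
      (hΦc t) hY hYE hKb hQ
      (fun c k hk => ⟨hK3a c k t hk ht'.le, hK3r c k t hk ht', hK3a c k (t + 1) hk ht⟩)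
      (hK1a (t + 1) ht) ⟨hK2a t ht'.le, hK2r t ht'⟩ hN (by omega) ihD hrow
    rw [Finset.sum_range_succ, Finset.sum_range_succ]
    refine hc.mono (le_of_eq ?_)
    ring

/-! ### The end game -/

/-- **Walking an empty parity down.** If `Dof κ = ∅` then from `⊢ Z(1,n,κ), K` one gets
`⊢ Z(1,n-j,κ), K` for every `j ≤ n` (axiom 3 with `y = ⊥` read backwards), `2^(N+2)+2` more
ticks per step. [Buss et al. 1997, Def. 1.1] [folklore] -/
theorem sq_walk_down (κ : ℕ)
    (hH3₁ : ∀ k κ, H3 1 k κ = PropForm.biimp (var (zv 1 (k + 1) κ))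
      (disj (conj (var (zv 1 k κ)) (neg (Y k κ))) (conj (var (zv 0 k κ)) (Y k κ))))
    (hY : ∀ k κ, Y k κ = var k ∨ Y k κ = const false)
    (hYe : ∀ k, Y k κ = const false)
    (hKb : ∀ A ∈ K, Base Q A) (hQ : 8 ≤ Q.D ∧ 40 ≤ Q.M)
    (hK3 : ∀ (c : ZMod 2) (k : ℕ), k < n → neg (H3 c k κ) ∈ K)
    {N : ℕ} (hN : 6000 ≤ N) (hW : K.length + N + 12 ≤ Q.W) {A : ℕ}
    (hfact : Sq Q A (var (zv 1 n κ) :: K)) :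
    ∀ j, j ≤ n → Sq Q (A + j * (2 ^ (N + 2) + 2)) (var (zv 1 (n - j) κ) :: K) := by
  intro j
  induction j with
  | zero => intro _; simpa using hfact
  | succ j ih =>
    intro hj
    have ihj := ih (Nat.le_of_succ_le hj)
    have hk : n - (j + 1) < n := by omega
    have hk1 : n - (j + 1) + 1 = n - j := by omega
    have h := sq_atom_step (Q := Q) (N := N) (z' := zv 1 (n - (j + 1)) κ)
      (Cs := [neg (H3 1 (n - (j + 1)) κ)]) ihj
      (by intro C hC; rw [List.mem_singleton] at hC; subst hC; exact hK3 1 _ hk)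
      (by simp)
      (by
        intro C hC; rw [List.mem_singleton] at hC; subst hC
        exact le_of_eq (bounds_H3 zv Y hY (hH3₁ (n - (j + 1)) κ)).2.1)
      hKb hQ (by omega) (by omega)
      (by
        intro τ hz hC
        have c1 := hC (neg (H3 1 (n - (j + 1)) κ)) (by simp)
        rw [hH3₁, hYe, hk1] at c1
        simp only [eval, eval_biimp, Bool.not_eq_false', hz] at c1
        simpa using c1)
    refine h.mono (le_of_eq ?_)
    ring

/-- **The refutation of the context.** If `⊢ Z(1,n,κ), K` within `A` ticks for a kind with
`Dof κ = ∅` whose skeleton hypotheses (axioms 2 and 3) are negated in `K`, then `⊢ K` within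
`A + n(2^(N+2)+2) + 2^(N+2) + 5` ticks: walk down to `Z(1,0,κ)`, which contradicts `¬Z(1,0,κ)`.
[Buss et al. 1997, Def. 1.1] [folklore] -/
theorem sq_refute (κ : ℕ)
    (hH3₁ : ∀ k κ, H3 1 k κ = PropForm.biimp (var (zv 1 (k + 1) κ))
      (disj (conj (var (zv 1 k κ)) (neg (Y k κ))) (conj (var (zv 0 k κ)) (Y k κ))))
    (hY : ∀ k κ, Y k κ = var k ∨ Y k κ = const false)
    (hYe : ∀ k, Y k κ = const false)
    (hKb : ∀ A ∈ K, Base Q A) (hQ : 8 ≤ Q.D ∧ 40 ≤ Q.M)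
    (hK3 : ∀ (c : ZMod 2) (k : ℕ), k < n → neg (H3 c k κ) ∈ K)
    (hK2 : neg (neg (var (zv 1 0 κ))) ∈ K)
    {N : ℕ} (hN : 6000 ≤ N) (hW : K.length + N + 12 ≤ Q.W) {A : ℕ}
    (hfact : Sq Q A (var (zv 1 n κ) :: K)) :
    Sq Q (A + n * (2 ^ (N + 2) + 2) + 2 ^ (N + 2) + 5) K := by
  have h0 := sq_walk_down zv Y H3 n K κ hH3₁ hY hYe hKb hQ hK3 hN hW hfact n le_rfl
  rw [Nat.sub_self] at h0
  have hlen := hfact.length_le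
  simp only [List.length_cons] at hlen
  -- `⊢ ⊥, K` from `Z(1,0,κ)` and `¬¬Z(1,0,κ) ∈ K`
  have h1 := sq_step (Q := Q) (K := K) (Fs := [var (zv 1 0 κ)]) (t := A + n * (2 ^ (N + 2) + 2))
    (N := N) (Cs := [neg (neg (var (zv 1 0 κ)))]) (G := const false)
    (by intro F hF; rw [List.mem_singleton] at hF; subst hF; exact h0)
    (by intro C hC; rw [List.mem_singleton] at hC; subst hC; exact hK2)
    hKb (Base.bot Q)
    (by
      intro F hF; rw [List.mem_singleton] at hF; subst hF
      exact base_of_bounds hQ (by simp [altDepth, altDepthAux]) (by simp [size]))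
    (by norm_num [size]; omega) (by simp; omega)
    (by
      intro τ hF hC
      have f := hF (var (zv 1 0 κ)) (by simp)
      have c := hC (neg (neg (var (zv 1 0 κ)))) (by simp)
      simp only [eval, Bool.not_not] at f c
      rw [f] at c
      exact absurd c (by decide))
  have h2 : Sq Q 1 (neg (const false) :: K) :=
    Sq.negBotMem (by
      intro C hC
      rcases List.mem_cons.1 hC with rfl | hC
      · exact Base.negBot Q
      · exact hKb C hC) (by simp; omega) List.mem_cons_self
  refine (Sq.cut h1 h2).mono ?_
  simp only [List.length_singleton]
  omega

end Chain

end Summit.PneNP.PneNP.Theorems.ModTwo
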